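import Literature.Topology.FourManifolds.BCSConstruction
import Literature.Topology.FourManifolds.BCSSignatureAdditivity
import Literature.Topology.FourManifolds.SmoothHomologicalOrientationProofs
import Literature.Topology.FourManifolds.HomotopySpheresProofs
import Literature.AlgebraicTopology.SingularHomology.ExcisionMayerVietorisProofs
import Literature.AlgebraicTopology.SingularHomology.UniversalCoefficientsFree
import Literature.AlgebraicTopology.SingularHomology.CohomologyFiniteness
import Literature.AlgebraicTopology.SingularHomology.BoundaryManifoldFiniteness
import Literature.AlgebraicTopology.SingularHomology.CompactManifoldFiniteness
import Literature.AlgebraicTopology.SingularHomology.HomologySpheres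
import HarnessLib

/-!
# Signatures add over boundary connected sums of null-cobordisms of homotopy spheres

M. Kervaire, J. Milnor, *Groups of homotopy spheres I*, Ann. of Math. 77 (1963), §2 p. 508 and
the Addendum to Lemma 2.2: if `S = bW_S`, `T = bW_T` with `W_S`, `W_T` oriented (and
s-parallelizable), then `U = S # T` bounds `W_U = W_S ♮ W_T` with
`σ(W_U) = σ(W_S) + σ(W_T)`. This file assembles the tree's pieces into the signature statement
for the packaged boundary connected sum `BCSModel` (`BCSConstruction.lean`):

* `HomotopySphere.add_mem_signatureSet_of_bcsModel` — for `σ ∈ signatureSet S` witnessed by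
  `W_S` and `τ ∈ signatureSet T` witnessed by `W_T`, and `W_U = W_S ♮ W_T` s-parallelizable,
  `σ + τ ∈ signatureSet U`: relative fundamental classes of the summands
  (`IsOrientedBy.exists_isRelFundamentalClass`) glue (`BCSGluing.exists_isRelFundamentalClass`),
  the glued class is oriented compatibly with `U` (`Piece.δ_eq_map_fundamentalClass`,
  `Piece.units_eq_one`), the closed model of `W_U` is `ℤ`-oriented by it
  (`closedModelOrientation`), and the signatures add (`BCSGluing.signatureInDim_eq_add`).

Supporting facts proved here: homotopy spheres of dimension `≥ 2` are simply connected (hence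
connected), their cohomology vanishes in degrees `0 < j < dim` (homology of spheres + universal
coefficients), and the cohomology of the closed model of a null-cobordism is finitely generated.

Everything is proved; no named facts. The s-parallelizability of `W_S ♮ W_T` is the remaining
input for `add_mem_signatureSet_of_isOrientedConnectedSum`.

## References

* M. A. Kervaire, J. W. Milnor, *Groups of homotopy spheres: I*, Ann. of Math. (2) 77 (1963),
  §2 p. 508, Lemma 2.2 and Addendum; §7 footnote pp. 528–529. [KervaireMilnorAnnals1963]
* A. Hatcher, *Algebraic Topology*, CUP 2002, §3.1 Cor. 3.3, §3.3. [HatcherAT2002]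
-/

noncomputable section

open scoped Manifold ContDiff Topology
open Set Function CategoryTheory CategoryTheory.Limits Topology TopologicalSpace
open Literature.AlgebraicTopology.SingularHomology

namespace Literature.Topology.FourManifolds

/-! ### Homotopy spheres: connectedness and cohomology -/

namespace HomotopySphere

variable {n : ℕ}

/-- The homology of a homotopy sphere is that of the sphere: `Hₖ(Σⁿ; ℤ) = 0` for `k ≠ 0, n`.
[cite: HatcherAT2002, Cor. 2.11 and Ex. 2.17] -/
theorem isZero_singularHomology (S : HomotopySphere n) {k : ℕ} (hk : k ≠ 0) (hkn : k ≠ n) :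
    IsZero (singularHomology ℤ ℤ S.carrier k) :=
  IsZero.of_iso (isZero_singularHomology_sphere_holds ℤ ℤ hk hkn)
    (singularHomology.isoOfHomotopyEquiv ℤ ℤ (Classical.choice S.nonempty_homotopyEquiv) k)

/-- **The cohomology of a homotopy sphere vanishes in degrees `0 < j < n`** (homology of the
sphere and universal coefficients: `Hʲ ≅ Hom(Hⱼ, ℤ)` when `Hⱼ₋₁` is free, Hatcher 2002, §3.1
Cor. 3.3). [cite: HatcherAT2002, §3.1 Cor. 3.3] -/
theorem isZero_singularCohomology (S : HomotopySphere n) {j : ℕ} (h1 : 1 ≤ j) (h2 : j < n) :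
    IsZero (singularCohomology ℤ ℤ S.carrier j) := by
  obtain ⟨i, rfl⟩ : ∃ i, j = i + 1 := ⟨j - 1, by omega⟩
  -- the Kronecker map `Hⁱ⁺¹ → Hom(Hᵢ₊₁, ℤ)` is bijective (`Hᵢ` is free: `ℤ` for `i = 0`, `0` else)
  have hbij : Bijective (kroneckerPairing ℤ ℤ S.carrier (i + 1)) := by
    rcases Nat.eq_zero_or_pos i with h0 | hpos
    · subst h0
      haveI := HomotopySphere.pathConnectedSpace (by omega) S
      haveI : Module.Free ℤ (singularHomology ℤ ℤ S.carrier 0) := free_singularHomology_zero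
      exact kroneckerPairing_bijective_of_free ℤ S.carrier 0
    · exact kroneckerPairing_bijective_of_isZero ℤ S.carrier i
        (S.isZero_singularHomology (by omega) (by omega))
  -- and its target vanishes since `Hᵢ₊₁ = 0`
  have hZ := S.isZero_singularHomology (k := i + 1) (by omega) (by omega)
  haveI : Subsingleton (singularHomology ℤ ℤ S.carrier (i + 1)) := ModuleCat.subsingleton_of_isZero hZ
  haveI : Subsingleton (Module.Dual ℤ (singularHomology ℤ ℤ S.carrier (i + 1))) := inferInstance
  haveI : Subsingleton (singularCohomology ℤ ℤ S.carrier (i + 1)) := hbij.1.subsingleton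
  exact ModuleCat.isZero_of_subsingleton _

end HomotopySphere

/-! ### Finiteness of the cohomology of the closed model -/

namespace NullCobordism

variable {m : ℕ} {M : Type} [TopologicalSpace M] [ChartedSpace (EuclideanSpace ℝ (Fin (m + 1))) M]
  [IsManifold (𝓡 (m + 1)) ∞ M] (c : NullCobordism (m + 1) M)

/-- **`Hⱼ(Ŵ; ℤ)` is finitely generated** for the closed model `Ŵ = W/∂W` of a null-cobordism of a
compact `M`: `Hⱼ(Ŵ, ∞) ≅ Hⱼ(W, ∂W)` (`isIso_map_boundaryCollapse`) is finitely generated (long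
exact sequence of the pair of compact manifolds, Hatcher 2002, Cor. A.8–A.9), and `Hⱼ(Ŵ)` is an
extension of a submodule of it by a quotient of `Hⱼ(pt)`. [cite: HatcherAT2002, App. A Cor. A.8 and A.9] -/
theorem finite_singularHomology_closedModel [CompactSpace M] [T2Space M] [Nonempty M]
    (κ : c.boundaryData.Collar) (j : ℕ) :
    Module.Finite ℤ (singularHomology ℤ ℤ (ClosedModel (m + 1) c.W) j) := by
  -- `Hⱼ(W, ∂W)` is finitely generated
  letI := boundaryTopChartedSpace (n := m + 1) (W := c.W)
  haveI : CompactSpace ↥((𝓡∂ (m + 1 + 1)).boundary c.W) := isCompact_iff_compactSpace.1 isCompact_boundary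
  have hbd : ∀ k, Module.Finite ℤ (singularHomology ℤ ℤ ↥((𝓡∂ (m + 1 + 1)).boundary c.W) k) := fun k => by
    haveI : Module.Finite ℤ (singularHomology ℤ ℤ M k) :=
      finite_singularHomology_of_compact_chartedSpace ℤ ℤ (d := m + 1) k
    exact Module.Finite.equiv (singularHomology.mapIso ℤ ℤ c.bdryHomeomorph k).toLinearEquiv
  have hrel : Module.Finite ℤ (relativeSingularHomology ℤ ℤ c.W ((𝓡∂ (m + 1 + 1)).boundary c.W) j) :=
    finite_relativeSingularHomology_of_finite ℤ ℤ _ j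
      (finite_singularHomology_of_compact_chartedSpace_halfSpace ℤ ℤ (n := m + 1) (W := c.W) j) (fun k _ => hbd k)
  -- hence `Hⱼ(Ŵ, ∞)`
  haveI := c.isIso_map_boundaryCollapse κ ℤ ℤ j
  haveI := hrel
  haveI hq : Module.Finite ℤ (relativeSingularHomology ℤ ℤ (ClosedModel (m + 1) c.W) {ClosedModel.infty} j) :=
    Module.Finite.equiv
      (asIso (relativeSingularHomology.map ℤ ℤ (boundaryCollapse (m + 1) c.W)
        (mapsTo_boundaryCollapse (m + 1) c.W) j)).toLinearEquiv
  -- `Hⱼ(pt)` is finitely generated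
  haveI hpt : Module.Finite ℤ (singularHomology ℤ ℤ ↥({ClosedModel.infty} : Set (ClosedModel (m + 1) c.W)) j) := by
    cases j with
    | zero =>
      haveI : PathConnectedSpace ↥({ClosedModel.infty} : Set (ClosedModel (m + 1) c.W)) :=
        PathConnectedSpace.of_locallyPathConnectedSpace
      exact finite_singularHomology_zero_of_pathConnectedSpace
    | succ i =>
      haveI := ModuleCat.subsingleton_of_isZero
        (isZero_singularHomology_of_subsingleton (R := ℤ) (M := ℤ)
          (X := ↥({ClosedModel.infty} : Set (ClosedModel (m + 1) c.W))) (n := i + 1) (by omega))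
      exact Module.Finite.of_surjective (0 : ℤ →ₗ[ℤ] _) fun x => ⟨0, Subsingleton.elim _ _⟩
  -- `Hⱼ(pt) → Hⱼ(Ŵ) → Hⱼ(Ŵ, ∞)` exact
  refine ⟨Submodule.fg_of_fg_map_of_fg_inf_ker
    (relativeSingularHomology.ofAbsolute ℤ ℤ (ClosedModel (m + 1) c.W) {ClosedModel.infty} j).hom ?_ ?_⟩
  · exact IsNoetherian.noetherian _
  · rw [top_inf_eq, ← (relativeSingularHomology.exact_map_ofAbsolute ℤ ℤ
      ({ClosedModel.infty} : Set (ClosedModel (m + 1) c.W)) j).moduleCat_range_eq_ker,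
      LinearMap.range_eq_map]
    exact Module.Finite.fg_top.map _

/-- **`Hᵏ(Ŵ; ℤ)` and `Hᵏ(Ŵ; ℤ)/torsion` are finitely generated.** [cite: HatcherAT2002, §3.1 Cor. 3.3] -/
theorem finite_freeCohomology_closedModel [CompactSpace M] [T2Space M] [Nonempty M]
    (κ : c.boundaryData.Collar) (k : ℕ) :
    Module.Finite ℤ (freeCohomology ℤ (ClosedModel (m + 1) c.W) k) := by
  haveI := fun j => c.finite_singularHomology_closedModel κ j
  haveI : Module.Finite ℤ (singularCohomology ℤ ℤ (ClosedModel (m + 1) c.W) k) :=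
    finite_singularCohomology_of_finite_singularHomology k fun j _ => inferInstance
  exact Module.Finite.of_surjective (Submodule.mkQ _) (Submodule.mkQ_surjective _)

end NullCobordism

/-! ### The signature statement for a packaged boundary connected sum -/

namespace HomotopySphere

variable {mm : ℕ}

/-- **Signatures add over the boundary connected sum** (Kervaire–Milnor 1963, §2 p. 508 with the
Addendum to Lemma 2.2): let `U = S # T` be an oriented connected sum of homotopy spheres of
dimension `mm + 1 = 4m - 1`, `B` the packaged boundary connected sum `W_U = W_S ♮ W_T` of
null-cobordisms `W_S`, `W_T` (`BCSModel`), and suppose `W_U` is s-parallelizable. If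
`σ = σ(W_S)`, `τ = σ(W_T)` for compatible orientations (`signatureSet` witnessed by `W_S`, `W_T`),
then `σ + τ ∈ signatureSet U`, witnessed by `W_U`. [cite: KervaireMilnorAnnals1963, §2 p. 508] -/
theorem add_mem_signatureSet_of_bcsModel {m : ℕ} (h : mm + 1 + 1 = 4 * m)
    (g : HomologicalOrientation ℤ (EuclideanSpace ℝ (Fin (mm + 1))) (mm + 1))
    (S T U : HomotopySphere (mm + 1))
    {cS : NullCobordism (mm + 1) S.carrier} {cT : NullCobordism (mm + 1) T.carrier}
    (B : BCSModel S T U cS cT)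
    (hsp : IsStablyParallelizable (𝓡∂ (mm + 1 + 1)) B.cU.W)
    {μS : HomologicalOrientation ℤ S.carrier (mm + 1)} {μT : HomologicalOrientation ℤ T.carrier (mm + 1)}
    (hμS : SmoothOrientation.IsCompatible g S.orientation μS)
    (hμT : SmoothOrientation.IsCompatible g T.orientation μT)
    {μ'S : HomologicalOrientation ℤ (ClosedModel (mm + 1) cS.W) (mm + 1 + 1)}
    {μ'T : HomologicalOrientation ℤ (ClosedModel (mm + 1) cT.W) (mm + 1 + 1)}
    (hobS : cS.IsOrientedBy μS μ'S) (hobT : cT.IsOrientedBy μT μ'T) :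
    μ'S.signatureInDim (show 2 * m + 2 * m = mm + 1 + 1 by omega) +
        μ'T.signatureInDim (show 2 * m + 2 * m = mm + 1 + 1 by omega) ∈
      signatureSet g m h U := by
  have hn : 1 ≤ mm + 1 := Nat.succ_pos mm
  have hmm : 2 ≤ mm + 1 := by omega
  haveI := HomotopySphere.connectedSpace (Nat.succ_ne_zero mm) S
  haveI := HomotopySphere.connectedSpace (Nat.succ_ne_zero mm) T
  haveI := HomotopySphere.connectedSpace (Nat.succ_ne_zero mm) U
  haveI : Nonempty S.carrier := S.nonempty_carrier
  haveI : Nonempty T.carrier := T.nonempty_carrier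
  haveI : Nonempty U.carrier := U.nonempty_carrier
  -- relative fundamental classes of the summands
  obtain ⟨wS, hwS, hfcS, hδS⟩ := NullCobordism.IsOrientedBy.exists_isRelFundamentalClass cS hn hobS
  obtain ⟨wT, hwT, hfcT, hδT⟩ := NullCobordism.IsOrientedBy.exists_isRelFundamentalClass cT hn hobT
  -- glue them
  obtain ⟨ε, wU, hwU, relS, relT⟩ := B.G.exists_isRelFundamentalClass hwS hwT
  -- the `ℤ`-orientation of `U` compatible with its smooth orientation
  obtain ⟨μU, hμU, -⟩ := SmoothOrientation.existsUnique_isCompatible_holds (n := mm + 1) (M := U.carrier)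
    g U.orientation
  -- the glued class is oriented by `μU` (compare on the `S` side) ...
  obtain ⟨sS⟩ := B.nonempty_linkS
  have hδU := NullCobordism.Piece.δ_eq_map_fundamentalClass B.LS g B.hopS hμS hμU hδS hwU relS sS
  -- ... so the sign on the `T` side is `+1`
  obtain ⟨sT⟩ := B.nonempty_linkT
  have hε : ε = 1 := NullCobordism.Piece.units_eq_one B.LT g B.hopT hμT hμU hδT hwU hδU ε relT sT
  subst hε
  -- the closed model of `W_U`, oriented by the glued class
  obtain ⟨κU⟩ := BoundaryData.nonempty_collar_of_compactSpace mm B.cU.W B.cU.boundaryData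
  let μ'U := B.cU.closedModelOrientation κU ℤ hn hwU
  have hfcU : μ'U.fundamentalClass = B.cU.closedModelClass ℤ ℤ hn wU :=
    B.cU.fundamentalClass_closedModelOrientation κU ℤ hn hwU
  have hobU : B.cU.IsOrientedBy μU μ'U :=
    ⟨wU, hδU, by rw [hfcU]; exact (B.cU.ofAbsolute_closedModelClass ℤ ℤ hn wU).symm⟩
  -- signatures add
  haveI := B.cU.finite_freeCohomology_closedModel κU (2 * m)
  haveI := cS.finite_freeCohomology_closedModel B.κS (2 * m)
  haveI := cT.finite_freeCohomology_closedModel B.κT (2 * m)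
  have hsig := B.G.signatureInDim_eq_add B.containsS B.containsT B.κS B.κT κU B.collarS B.collarT
    ?_ (show 2 * m + 2 * m = mm + 1 + 1 by omega) (even_two_mul m) (by omega)
    (fun j h1 h2 => S.isZero_singularCohomology h1 (by omega))
    (fun j h1 h2 => T.isZero_singularCohomology h1 (by omega))
    (fun j h1 h2 => U.isZero_singularCohomology h1 (by omega))
    wS wT wU relS (fun y hy => by rw [relT y hy, Units.val_one, one_smul]) μ'U μ'S μ'T hfcU hfcS hfcT
  · exact ⟨μU, B.cU, μ'U, hμU, hsp, hobU, hsig⟩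
  · -- the interior overlap is contractible
    have hset : range (NullCobordism.Piece.interiorEmb B.containsS) ∩
        range (NullCobordism.Piece.interiorEmb B.containsT) =
        {z : ManifoldInterior (mm + 1) B.cU.W | z.1 ∈ range B.G.S.j ∩ range B.G.T.j} := by
      ext z
      simp only [mem_inter_iff, mem_setOf_eq, NullCobordism.Piece.mem_range_interiorEmb_iff]
    rw [hset]
    exact B.contractible_overlap

end HomotopySphere

end Literature.Topology.FourManifolds
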